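import Mathlib
import HarnessLib
import Summits.HubbardSuperconductivity.HubbardSuperconductivity.Theorems.KLProgrammeKLRegimeTwoVolumeDualRowsLastScaleConversion
import Summits.HubbardSuperconductivity.HubbardSuperconductivity.Theorems.KLProgrammeKLRegimeTwoVolumeFrameConversionRowsFourier

/-!
# Route `KLProgramme` — crux K3 ENGINE (stmt-HubbardSuperconductivity-20437 `KLRegimeEngineV17F2`), stub (e) proof-input «(e)-D-ROWS», keying (A′) (pen (R495)):
# THE CONVERSION ROWS AT ANY SCALE `n` — `Pe ≤ N_D²·ρ̃ + 2·N_D·ρ̃·(2 + ε·N_D·ρ̃)·S_G + 2·R` modulo the RESUMMED-symbol rows `ρ̃`, the raw rows `S_G` of the responded action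
# `G = effAction_{normalCovariance d}(T(K₁))` and the RESPONSE rows `R` of `G − T(K₁)`
# (cell gate-hubbard-kl, seat hubbard-kl-k3c4-p1 g27, VL lane; file (1c)(iv) of the order of record (R495)(C) MODULO located #11 «VL-CONV-RESPONSE-ROWS»)

At an intermediate scale `Λ_n` (no `Λ_n ≤ π/β`) the frame conversion of `T(K) − 𝒩_K` on one volume is (✓ p732040 `klEffectiveAction_sub_counterQuadratic_frame_eq`, k3c4-p2's
`klEffectiveAction_eq_chain_add_map_nearIdentity`): `(effAction_{Ψ_{K₂}}(𝒩_D) − 𝒩_D) + (S_m·G − G) + (G − T(K₁))`, `G = effAction_{normalCovariance d}(T(K₁))`,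
`d = Ψ̃ − Ψ_{K₁}` SINGLE-SCALE, `Ψ̃ = Ψ_{K₂}/(1 + Ψ_{K₂}κ_D)`, `m = (1 + Ψ_{K₂}κ_D)⁻¹`.  The algebra of the last-scale files holds VERBATIM with `Ψ̃` in place of `Ψ_{K₁}`:
`m − 1 = −κ_D·Ψ̃` and chain symbol `= −κ_D²·Ψ̃` (no smallness: `1 + Ψ_{K₂}κ_D ≠ 0`, k3c4-p2's `one_add_uvSymbolCT_mul_ofReal_ne_zero`).  Hence, with
`N_D ≥ Σ_z‖framePosKernel L₂ D z‖`, `ρ̃ ≥` the `2M₂`-lattice grid character sum of `Ψ̃` (every spin), `S_G ≥` the `ε`-weighted pinned raw two-leg rows of `G`, and `R ≥` the full pinned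
raw two-leg rows of the RESPONSE `G − T(K₁)` at the fine pin:

* §1 `dressWeight_sub_one_eq_resummed`, `chainSymbol_eq_resummed`, **`sum_norm_chainCharSum_le_resummed`** (`Xχ ≤ N_D²·ρ̃/2` at any scale);
* §2 **`hPe_le_of_fourier_resummed`** (`Pe ≤ N_D²·ρ̃ + 2·N_D·ρ̃·(2 + ε·N_D·ρ̃)·S_G + 2·R`), **`hdualSp_point_of_fourier_resummed`** (∘ ✓ `hdualSp_point_of_commonFrame_add_conversion`).

LEFT NAMED (located #11, FRAME-CONVERSION-LEDGER-g27.md §4): `ρ̃ ≤ ρ(Ψ_{K₁}) + ρ(d)` and `R` need position rows of `d` WITH the `|D|`-gain — not in the tree.  At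
`n = nScales β + 1` (`d ≡ 0`, `R = 0`) §2 is `…DualRowsLastScaleFourier.hPe_lastScale_le_of_fourier`.  Pure composition; nothing asserts the data, hVL, K3 or superconductivity.
References: BGM 2006 §2.3 (2.21)–(2.24), §2.4 (2.38), §2.7 (2.71a), §3 (3.3) [cite: BenfattoGiulianiMastropietro2006]; Feldman–Salmhofer–Trubowitz 1996 §1.
-/

noncomputable section

namespace Summit.HubbardSuperconductivity.HubbardSuperconductivity.Theorems.TwoVolumeDefect

set_option linter.dupNamespace false -- summit = problem name (single-conjunct summit), D-0017

open Finset Complex Literature.MathematicalPhysics.QuantumLattice Literature.Probability.LatticeModels GrassmannAlgebra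
open Summit.HubbardSuperconductivity.HubbardSuperconductivity.Theorems.KLRegimeSplit
open Summit.HubbardSuperconductivity.HubbardSuperconductivity.Theorems.KLProgrammeLegKernels
open Summit.HubbardSuperconductivity.HubbardSuperconductivity.Theorems.TorusFourierL2

/-! ## §1 The dressing and chain symbols at any scale, through the resummed symbol `Ψ̃` -/

section Resummed

variable {L M : ℕ} [NeZero L] [NeZero M] {β : ℝ} (hβ : 0 < β) (μ : ℝ) (K₁ K₂ : TrigPolyC4v) (Λ : ℝ)
include hβ

omit [NeZero M] in
/-- **`m − 1 = −κ_D·Ψ̃` at ANY scale**: `(1 + Ψ_{K₂}κ_D)⁻¹ − 1 = −(κ_D·(Ψ_{K₂}/(1 + Ψ_{K₂}κ_D)))` (`1 + Ψ_{K₂}κ_D ≠ 0`). [cite: FeldmanSalmhoferTrubowitz1996, §1] -/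
theorem dressWeight_sub_one_eq_resummed (ks : FreqMomentum L M × Fin 2) :
    (1 + uvSymbolCT L M β μ K₂ Λ ks * (((fsub K₂ K₁).eval (latticeMomentum L ks.1.2) / (β * (L : ℝ) ^ 2) : ℝ) : ℂ))⁻¹ - 1 =
      -((((fsub K₂ K₁).eval (latticeMomentum L ks.1.2) / (β * (L : ℝ) ^ 2) : ℝ) : ℂ) *
        (uvSymbolCT L M β μ K₂ Λ ks / (1 + uvSymbolCT L M β μ K₂ Λ ks * (((fsub K₂ K₁).eval (latticeMomentum L ks.1.2) / (β * (L : ℝ) ^ 2) : ℝ) : ℂ)))) := by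
  have hden := one_add_uvSymbolCT_mul_ofReal_ne_zero hβ μ K₂ Λ ((fsub K₂ K₁).eval (latticeMomentum L ks.1.2)) ks
  field_simp
  ring

omit [NeZero M] in
/-- **The chain symbol at ANY scale**: `κ_D/(1 + Ψ_{K₂}κ_D) − κ_D = −κ_D²·Ψ̃`. [cite: FeldmanSalmhoferTrubowitz1996, §1] -/
theorem chainSymbol_eq_resummed (ks : FreqMomentum L M × Fin 2) :
    (((fsub K₂ K₁).eval (latticeMomentum L ks.1.2) / (β * (L : ℝ) ^ 2) : ℝ) : ℂ) /
          (1 + uvSymbolCT L M β μ K₂ Λ ks * (((fsub K₂ K₁).eval (latticeMomentum L ks.1.2) / (β * (L : ℝ) ^ 2) : ℝ) : ℂ)) -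
        (((fsub K₂ K₁).eval (latticeMomentum L ks.1.2) / (β * (L : ℝ) ^ 2) : ℝ) : ℂ) =
      -((((fsub K₂ K₁).eval (latticeMomentum L ks.1.2) / (β * (L : ℝ) ^ 2) : ℝ) : ℂ) *
        (((fsub K₂ K₁).eval (latticeMomentum L ks.1.2) / (β * (L : ℝ) ^ 2) : ℝ) : ℂ) *
          (uvSymbolCT L M β μ K₂ Λ ks / (1 + uvSymbolCT L M β μ K₂ Λ ks * (((fsub K₂ K₁).eval (latticeMomentum L ks.1.2) / (β * (L : ℝ) ^ 2) : ℝ) : ℂ)))) := by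
  have hm := dressWeight_sub_one_eq_resummed hβ μ K₁ K₂ Λ ks
  set d : ℂ := (((fsub K₂ K₁).eval (latticeMomentum L ks.1.2) / (β * (L : ℝ) ^ 2) : ℝ) : ℂ) with hd
  calc d / (1 + uvSymbolCT L M β μ K₂ Λ ks * d) - d = d * ((1 + uvSymbolCT L M β μ K₂ Λ ks * d)⁻¹ - 1) := by
        rw [div_eq_mul_inv]; ring
    _ = d * -(d * (uvSymbolCT L M β μ K₂ Λ ks / (1 + uvSymbolCT L M β μ K₂ Λ ks * d))) := by rw [hm]
    _ = _ := by ring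

/-- **The pin character sum of the chain symbol at ANY scale is `≤ N_D²·ρ̃/2`**, `ρ̃ ≥` the grid character sum (at `N = 2M`, spin `σ`) of the RESUMMED symbol
`Ψ̃ = Ψ_{K₂}/(1 + Ψ_{K₂}κ_D)`. [cite: BenfattoGiulianiMastropietro2006, §2.3 (2.21)–(2.24), §3 (3.3)] -/
theorem sum_norm_chainCharSum_le_resummed {N_D ρ : ℝ} (hND : ∑ z : TorusSite 2 L, ‖framePosKernel L (fsub K₂ K₁) z‖ ≤ N_D) (σ : Fin 2)
    (hρ : ∑ a : TorusSite 1 (2 * M), ∑ bv : TorusSite 2 L, ‖∑ q₀ : TorusSite 1 (2 * M), ∑ qv : TorusSite 2 L,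
      torusChar q₀ a * torusChar qv bv * gridSymbol L M (2 * M) β (fun ks : FreqMomentum L M × Fin 2 =>
        uvSymbolCT L M β μ K₂ Λ ks / (1 + uvSymbolCT L M β μ K₂ Λ ks * (((fsub K₂ K₁).eval (latticeMomentum L ks.1.2) / (β * (L : ℝ) ^ 2) : ℝ) : ℂ))) σ q₀ qv‖ ≤ ρ)
    (x₀ : SpaceTimeIdx L M) :
    ∑ x₁ : SpaceTimeIdx L M, ‖∑ k : FreqMomentum L M,
        ((((fsub K₂ K₁).eval (latticeMomentum L k.2) / (β * (L : ℝ) ^ 2) : ℝ) : ℂ) /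
              (1 + uvSymbolCT L M β μ K₂ Λ (k, σ) * (((fsub K₂ K₁).eval (latticeMomentum L k.2) / (β * (L : ℝ) ^ 2) : ℝ) : ℂ)) -
            (((fsub K₂ K₁).eval (latticeMomentum L k.2) / (β * (L : ℝ) ^ 2) : ℝ) : ℂ)) * (((2 : ℕ).factorial : ℚ)⁻¹ • (1 : ℂ)) *
          (Complex.exp (((matsubaraFreq β M k.1 * (imagTime β M x₁.1 - imagTime β M x₀.1) : ℝ) : ℂ) * I) * torusChar k.2 (x₁.2 - x₀.2))‖ ≤
      N_D ^ 2 * ρ / 2 := by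
  have hL : (0 : ℝ) < (L : ℝ) ^ 2 := by have := NeZero.pos L; positivity
  have hL1 : (L : ℝ) ≠ 0 := by exact_mod_cast NeZero.ne L
  have hc0 : (0 : ℝ) < β * (L : ℝ) ^ 2 := by positivity
  rw [sum_norm_pinCharSum_eq hβ.ne']
  set Ψt : FreqMomentum L M × Fin 2 → ℂ := fun ks =>
    uvSymbolCT L M β μ K₂ Λ ks / (1 + uvSymbolCT L M β μ K₂ Λ ks * (((fsub K₂ K₁).eval (latticeMomentum L ks.1.2) / (β * (L : ℝ) ^ 2) : ℝ) : ℂ)) with hΨt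
  set c : ℂ := -((((1 / (β * (L : ℝ) ^ 2) : ℝ) : ℂ)) ^ 2 * (((2 : ℕ).factorial : ℚ)⁻¹ • (1 : ℂ))) with hc
  have hsym : ∀ q : TorusSite 1 (2 * M) × TorusSite 2 L,
      ((((fsub K₂ K₁).eval (latticeMomentum L q.2) / (β * (L : ℝ) ^ 2) : ℝ) : ℂ) /
            (1 + uvSymbolCT L M β μ K₂ Λ ((⟨(q.1 0).val, ZMod.val_lt (q.1 0)⟩, q.2), σ) *
              (((fsub K₂ K₁).eval (latticeMomentum L q.2) / (β * (L : ℝ) ^ 2) : ℝ) : ℂ)) -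
          (((fsub K₂ K₁).eval (latticeMomentum L q.2) / (β * (L : ℝ) ^ 2) : ℝ) : ℂ)) * (((2 : ℕ).factorial : ℚ)⁻¹ • (1 : ℂ)) =
        (((fsub K₂ K₁).eval (latticeMomentum L q.2) : ℂ) * ((fsub K₂ K₁).eval (latticeMomentum L q.2) : ℂ)) *
          (c * Ψt ((⟨(q.1 0).val, ZMod.val_lt (q.1 0)⟩, q.2), σ)) := by
    intro q
    have h := chainSymbol_eq_resummed hβ μ K₁ K₂ Λ ((⟨(q.1 0).val, ZMod.val_lt (q.1 0)⟩, q.2), σ)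
    simp only at h
    rw [h, hc, hΨt]
    push_cast
    ring
  simp_rw [hsym]
  have hmain := sum_norm_charSum_evalSqMul_le hβ.ne' (fsub K₂ K₁) Ψt c σ hND hρ
  have hnc : ‖c‖ * (β * (L : ℝ) ^ 2) ^ 2 = 1 / 2 := by
    rw [hc, norm_neg, norm_mul, norm_pow, Complex.norm_real, Real.norm_eq_abs, abs_of_pos (by positivity)]
    have h2 : ‖(((2 : ℕ).factorial : ℚ)⁻¹ • (1 : ℂ))‖ = 1 / 2 := by
      rw [Nat.factorial_two]; norm_num
    rw [h2]
    field_simp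
  calc _ ≤ ‖c‖ * (β * (L : ℝ) ^ 2) ^ 2 * N_D ^ 2 * ρ := hmain
    _ = N_D ^ 2 * ρ / 2 := by rw [hnc]; ring

end Resummed

/-! ## §2 The conversion rows at any scale `n`: chain + dressing of `G` + response -/

section AnyScale

variable {L₁ L₂ M₂ : ℕ} [NeZero L₁] [NeZero L₂] [NeZero M₂]

/-- **THE CONVERSION ROWS AT ANY SCALE `n`.**  Fine volume `L₂`, coarse `L₁ ≤ L₂`, `0 < β`, frames `K₁ = klFlowFrameU L₁ M₂ … n`, `K₂ = klFlowFrameU L₂ M₂ … n`, `D = K₂ ⊖ K₁`,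
`Ψ_K = uvSymbolCT … K Λ_n`, `Ψ̃ = Ψ_{K₂}/(1+Ψ_{K₂}κ_D)`, `d = Ψ̃ − Ψ_{K₁}`, `G = effAction_{normalCovariance d}(T^{L₂}(K₁))`; both undressed partition functions nonzero / a unit.
DATA: `N_D ≥ Σ_z‖framePosKernel L₂ D z‖`; `ρ̃ ≥` the `2M₂`-lattice grid character sum of `Ψ̃` (every spin); `S_G ≥` the `ε`-weighted pinned raw two-leg rows of `G`; `R ≥` the full pinned
raw two-leg rows of the RESPONSE `G − T(K₁)` at `of`.  THEN the `hPe` rows of `hPd_of_commonFrame_add_conversion` are `≤ N_D²·ρ̃ + 2·N_D·ρ̃·(2 + ε·N_D·ρ̃)·S_G + 2·R`.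
[cite: BenfattoGiulianiMastropietro2006, §2.3 (2.21)–(2.24), §2.7 (2.71a), §3 (3.3)] -/
theorem hPe_le_of_fourier_resummed (hL : L₁ ≤ L₂) {β : ℝ} (hβ : 0 < β) (U μ : ℝ) (n : ℕ) (of : SpaceTimeIdx L₂ M₂)
    (hZ₂ : effPartitionFn ℂ (normalCovariance L₂ M₂ (uvSymbolCT L₂ M₂ β μ (klFlowFrameU L₂ M₂ β U μ n) (klScale klE0 n)))
      (hubbardInteraction L₂ M₂ β U + counterQuadratic L₂ M₂ β (klFlowFrameU L₂ M₂ β U μ n)) ≠ 0)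
    (hZ₁ : IsUnit (effPartitionFn ℂ (normalCovariance L₂ M₂ (uvSymbolCT L₂ M₂ β μ (klFlowFrameU L₁ M₂ β U μ n) (klScale klE0 n)))
      (hubbardInteraction L₂ M₂ β U + counterQuadratic L₂ M₂ β (klFlowFrameU L₁ M₂ β U μ n))))
    {N_D ρ S_G R : ℝ} (hSG0 : 0 ≤ S_G)
    (hND : ∑ z : TorusSite 2 L₂, ‖framePosKernel L₂ (fsub (klFlowFrameU L₂ M₂ β U μ n) (klFlowFrameU L₁ M₂ β U μ n)) z‖ ≤ N_D)
    (hρ : ∀ τ : Fin 2, ∑ a : TorusSite 1 (2 * M₂), ∑ bv : TorusSite 2 L₂, ‖∑ q₀ : TorusSite 1 (2 * M₂), ∑ qv : TorusSite 2 L₂,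
      torusChar q₀ a * torusChar qv bv *
        gridSymbol L₂ M₂ (2 * M₂) β (fun ks : FreqMomentum L₂ M₂ × Fin 2 =>
          uvSymbolCT L₂ M₂ β μ (klFlowFrameU L₂ M₂ β U μ n) (klScale klE0 n) ks /
            (1 + uvSymbolCT L₂ M₂ β μ (klFlowFrameU L₂ M₂ β U μ n) (klScale klE0 n) ks *
              (((fsub (klFlowFrameU L₂ M₂ β U μ n) (klFlowFrameU L₁ M₂ β U μ n)).eval (latticeMomentum L₂ ks.1.2) / (β * (L₂ : ℝ) ^ 2) : ℝ) : ℂ))) τ q₀ qv‖ ≤ ρ)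
    (hS : ∀ (σ : Fin 2) (y₀ : SpaceTimeIdx L₂ M₂),
      fixedTupleL1 L₂ M₂ β 1 (sectorisedKernel L₂ M₂ β (trivialMultiplier L₂ M₂)
          (effAction ℂ (normalCovariance L₂ M₂ fun ks : FreqMomentum L₂ M₂ × Fin 2 =>
              uvSymbolCT L₂ M₂ β μ (klFlowFrameU L₂ M₂ β U μ n) (klScale klE0 n) ks /
                  (1 + uvSymbolCT L₂ M₂ β μ (klFlowFrameU L₂ M₂ β U μ n) (klScale klE0 n) ks *
                    (((fsub (klFlowFrameU L₂ M₂ β U μ n) (klFlowFrameU L₁ M₂ β U μ n)).eval (latticeMomentum L₂ ks.1.2) / (β * (L₂ : ℝ) ^ 2) : ℝ) : ℂ)) -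
                uvSymbolCT L₂ M₂ β μ (klFlowFrameU L₁ M₂ β U μ n) (klScale klE0 n) ks)
            (klEffectiveAction L₂ M₂ β U μ (klFlowFrameU L₁ M₂ β U μ n) klE0 n)) 2)
        (![((0, σ), 0), ((0, σ), 1)] : Fin 2 → SectorLeg 1) y₀ ≤ S_G)
    (hR : ∀ σ : Fin 2, ∑ x₁ : SpaceTimeIdx L₂ M₂, ‖sectorisedKernel L₂ M₂ β (trivialMultiplier L₂ M₂)
        (effAction ℂ (normalCovariance L₂ M₂ fun ks : FreqMomentum L₂ M₂ × Fin 2 =>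
              uvSymbolCT L₂ M₂ β μ (klFlowFrameU L₂ M₂ β U μ n) (klScale klE0 n) ks /
                  (1 + uvSymbolCT L₂ M₂ β μ (klFlowFrameU L₂ M₂ β U μ n) (klScale klE0 n) ks *
                    (((fsub (klFlowFrameU L₂ M₂ β U μ n) (klFlowFrameU L₁ M₂ β U μ n)).eval (latticeMomentum L₂ ks.1.2) / (β * (L₂ : ℝ) ^ 2) : ℝ) : ℂ)) -
                uvSymbolCT L₂ M₂ β μ (klFlowFrameU L₁ M₂ β U μ n) (klScale klE0 n) ks)
            (klEffectiveAction L₂ M₂ β U μ (klFlowFrameU L₁ M₂ β U μ n) klE0 n) -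
          klEffectiveAction L₂ M₂ β U μ (klFlowFrameU L₁ M₂ β U μ n) klE0 n) 2
        (![((0, σ), 0), ((0, σ), 1)] : Fin 2 → SectorLeg 1) ![of, x₁]‖ ≤ R)
    (σ : Fin 2) :
    ∑ t₁ : ImagTimeIdx M₂, ∑ ybar : TorusSite 2 L₁,
        (‖sectorisedKernel L₂ M₂ β (trivialMultiplier L₂ M₂)
              ((klEffectiveAction L₂ M₂ β U μ (klFlowFrameU L₁ M₂ β U μ n) klE0 n - counterQuadratic L₂ M₂ β (klFlowFrameU L₁ M₂ β U μ n)) -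
                (klEffectiveAction L₂ M₂ β U μ (klFlowFrameU L₂ M₂ β U μ n) klE0 n - counterQuadratic L₂ M₂ β (klFlowFrameU L₂ M₂ β U μ n))) 2
              (![((0, σ), 0), ((0, σ), 1)] : Fin 2 → SectorLeg 1) ![of, (t₁, of.2 + Torus.proj L₂ (Torus.cRep ybar))]‖ +
          ‖sectorisedKernel L₂ M₂ β (trivialMultiplier L₂ M₂)
              ((klEffectiveAction L₂ M₂ β U μ (klFlowFrameU L₁ M₂ β U μ n) klE0 n - counterQuadratic L₂ M₂ β (klFlowFrameU L₁ M₂ β U μ n)) -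
                (klEffectiveAction L₂ M₂ β U μ (klFlowFrameU L₂ M₂ β U μ n) klE0 n - counterQuadratic L₂ M₂ β (klFlowFrameU L₂ M₂ β U μ n))) 2
              (![((0, σ), 0), ((0, σ), 1)] : Fin 2 → SectorLeg 1) ![of, (t₁, of.2 + -Torus.proj L₂ (Torus.cRep ybar))]‖) ≤
      N_D ^ 2 * ρ + 2 * N_D * ρ * (2 + imagTimeWeight β M₂ * N_D * ρ) * S_G + 2 * R := by
  set K₁ := klFlowFrameU L₁ M₂ β U μ n with hK₁
  set K₂ := klFlowFrameU L₂ M₂ β U μ n with hK₂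
  set Λn := klScale klE0 n with hΛn
  set T₁ := klEffectiveAction L₂ M₂ β U μ K₁ klE0 n with hT₁
  set ε := imagTimeWeight β M₂ with hεdef
  set Ψt : FreqMomentum L₂ M₂ × Fin 2 → ℂ := fun ks =>
    uvSymbolCT L₂ M₂ β μ K₂ Λn ks / (1 + uvSymbolCT L₂ M₂ β μ K₂ Λn ks * (((fsub K₂ K₁).eval (latticeMomentum L₂ ks.1.2) / (β * (L₂ : ℝ) ^ 2) : ℝ) : ℂ)) with hΨt
  set G := effAction ℂ (normalCovariance L₂ M₂ fun ks : FreqMomentum L₂ M₂ × Fin 2 => Ψt ks - uvSymbolCT L₂ M₂ β μ K₁ Λn ks) T₁ with hG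
  set A := effAction ℂ (normalCovariance L₂ M₂ (uvSymbolCT L₂ M₂ β μ K₂ Λn)) (counterQuadratic L₂ M₂ β (fsub K₂ K₁)) -
    counterQuadratic L₂ M₂ β (fsub K₂ K₁) with hA
  set c : HubbardFieldIdx L₂ M₂ → ℂ := fun X => (1 + uvSymbolCT L₂ M₂ β μ K₂ Λn X.1 *
    (((fsub K₂ K₁).eval (latticeMomentum L₂ X.1.1.2) / (β * (L₂ : ℝ) ^ 2) : ℝ) : ℂ))⁻¹ with hc
  set v : FreqMomentum L₂ M₂ → ℂ := fun k => (1 + uvSymbolCT L₂ M₂ β μ K₂ Λn (k, 0) *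
    (((fsub K₂ K₁).eval (latticeMomentum L₂ k.2) / (β * (L₂ : ℝ) ^ 2) : ℝ) : ℂ))⁻¹ with hv
  have hcv : ∀ X, c X = v X.1.1 := fun X => dress_weight_momentum β μ K₂ K₁ Λn X
  set B := ExteriorAlgebra.map (LinearMap.mulLeft ℂ c) G - G with hB
  set Rsp := G - T₁ with hRsp
  have hMr : (0 : ℝ) < M₂ := Nat.cast_pos.2 (Nat.pos_of_ne_zero (NeZero.ne M₂))
  have hε : 0 < ε := by rw [hεdef]; unfold imagTimeWeight; positivity
  have hL2 : (0 : ℝ) < (L₂ : ℝ) ^ 2 := by have := NeZero.pos L₂; positivity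
  have hL1 : (L₂ : ℝ) ≠ 0 := by exact_mod_cast NeZero.ne L₂
  have hc0 : (0 : ℝ) < β * (L₂ : ℝ) ^ 2 := by positivity
  have hN0 : 0 ≤ N_D := (sum_nonneg fun _ _ => norm_nonneg _).trans hND
  have hρ0 : 0 ≤ ρ := le_trans (sum_nonneg fun _ _ => sum_nonneg fun _ _ => norm_nonneg _) (hρ 0)
  have hconv : (T₁ - counterQuadratic L₂ M₂ β K₁) - (klEffectiveAction L₂ M₂ β U μ K₂ klE0 n - counterQuadratic L₂ M₂ β K₂) = -(A + B + Rsp) := by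
    rw [klEffectiveAction_sub_counterQuadratic_frame_eq hβ U μ K₁ K₂ klE0 n hZ₂ hZ₁]
    simp only [hA, hB, hRsp, hG, hT₁, hΨt, hΛn]
    abel
  have hker_add : ∀ (P Q : HubbardGrassmann L₂ M₂) (x : Fin 2 → SpaceTimeIdx L₂ M₂),
      sectorisedKernel L₂ M₂ β (trivialMultiplier L₂ M₂) (P + Q) 2 (![((0, σ), 0), ((0, σ), 1)] : Fin 2 → SectorLeg 1) x =
        sectorisedKernel L₂ M₂ β (trivialMultiplier L₂ M₂) P 2 (![((0, σ), 0), ((0, σ), 1)] : Fin 2 → SectorLeg 1) x +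
          sectorisedKernel L₂ M₂ β (trivialMultiplier L₂ M₂) Q 2 (![((0, σ), 0), ((0, σ), 1)] : Fin 2 → SectorLeg 1) x := by
    intro P Q x
    have h2 := congrFun (congrFun (sectorisedKernel_add β (trivialMultiplier L₂ M₂) P Q 2) (![((0, σ), 0), ((0, σ), 1)] : Fin 2 → SectorLeg 1)) x
    simpa only [Pi.add_apply] using h2
  have hker_neg : ∀ (P : HubbardGrassmann L₂ M₂) (x : Fin 2 → SpaceTimeIdx L₂ M₂),
      sectorisedKernel L₂ M₂ β (trivialMultiplier L₂ M₂) (-P) 2 (![((0, σ), 0), ((0, σ), 1)] : Fin 2 → SectorLeg 1) x =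
        -sectorisedKernel L₂ M₂ β (trivialMultiplier L₂ M₂) P 2 (![((0, σ), 0), ((0, σ), 1)] : Fin 2 → SectorLeg 1) x := by
    intro P x
    have h1 := sectorisedKernel_sub_apply β (trivialMultiplier L₂ M₂) (0 : HubbardGrassmann L₂ M₂) P 2 (![((0, σ), 0), ((0, σ), 1)] : Fin 2 → SectorLeg 1) x
    rw [zero_sub, sectorisedKernel_zero] at h1
    rw [h1]
    simp
  have hpt : ∀ x : Fin 2 → SpaceTimeIdx L₂ M₂,
      ‖sectorisedKernel L₂ M₂ β (trivialMultiplier L₂ M₂) (-(A + B + Rsp)) 2 (![((0, σ), 0), ((0, σ), 1)] : Fin 2 → SectorLeg 1) x‖ ≤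
        ‖sectorisedKernel L₂ M₂ β (trivialMultiplier L₂ M₂) A 2 (![((0, σ), 0), ((0, σ), 1)] : Fin 2 → SectorLeg 1) x‖ +
          ‖sectorisedKernel L₂ M₂ β (trivialMultiplier L₂ M₂) B 2 (![((0, σ), 0), ((0, σ), 1)] : Fin 2 → SectorLeg 1) x‖ +
          ‖sectorisedKernel L₂ M₂ β (trivialMultiplier L₂ M₂) Rsp 2 (![((0, σ), 0), ((0, σ), 1)] : Fin 2 → SectorLeg 1) x‖ := by
    intro x
    rw [hker_neg, norm_neg, hker_add, hker_add]
    exact (norm_add_le _ _).trans (add_le_add (norm_add_le _ _) le_rfl)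
  -- (i) the chain rows
  have hArow : ∑ x₁ : SpaceTimeIdx L₂ M₂, ‖sectorisedKernel L₂ M₂ β (trivialMultiplier L₂ M₂) A 2
      (![((0, σ), 0), ((0, σ), 1)] : Fin 2 → SectorLeg 1) ![of, x₁]‖ ≤ N_D ^ 2 * ρ / 2 := by
    rw [hA, pinnedRow_two_chain_eq hβ μ K₂ K₂ K₁ Λn σ of]
    exact sum_norm_chainCharSum_le_resummed hβ μ K₁ K₂ Λn hND σ (hρ σ) of
  -- (ii) the dressing rows: `![1, v − 1, v]` with `v − 1 = D(p)·(c₀·Ψ̃)`, `c₀ = −(βL²)⁻¹`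
  set c₀ : ℂ := -(((1 / (β * (L₂ : ℝ) ^ 2) : ℝ) : ℂ)) with hc₀
  have hnc : ‖c₀‖ * (β * (L₂ : ℝ) ^ 2) = 1 := by
    rw [hc₀, norm_neg, Complex.norm_real, Real.norm_eq_abs, abs_of_pos (by positivity)]; field_simp
  set F' : Fin 3 → FreqMomentum L₂ M₂ → ℂ := ![fun _ => 1, fun k => v k - 1, v] with hF'
  have hF1 : ∀ k : FreqMomentum L₂ M₂, F' 1 k = ((fsub K₂ K₁).eval (latticeMomentum L₂ k.2) : ℂ) * (c₀ * Ψt (k, 0)) := by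
    intro k
    have hm := dressWeight_sub_one_eq_resummed hβ μ K₁ K₂ Λn (k, 0)
    simp only at hm
    have e1 : F' 1 k = v k - 1 := rfl
    rw [e1, hv]; dsimp only; rw [hm, hc₀, hΨt]; push_cast; ring
  have hF2 : ∀ k : FreqMomentum L₂ M₂, F' 2 k = 1 + ((fsub K₂ K₁).eval (latticeMomentum L₂ k.2) : ℂ) * (c₀ * Ψt (k, 0)) := by
    intro k
    have e1 : F' 1 k = v k - 1 := rfl
    have e2 : F' 2 k = v k := rfl
    rw [← hF1, e1, e2]; ring
  have hRδ : ∑ y : SpaceTimeIdx L₂ M₂,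
      ‖(sectorAnalysisMatrix L₂ M₂ β F' * sectorSubMatrix L₂ M₂ β (trivialMultiplier L₂ M₂)) (of, (((1 : Fin 3), σ), 0)) (y, (((0 : Fin 1), σ), 0))‖ ≤
      ε * N_D * ρ / ε := by
    refine (rowSum_overlap_evalMul_le hβ F' 1 (fsub K₂ K₁) Ψt c₀ 0 hF1 hND (hρ 0) σ 0 of).trans (le_of_eq ?_)
    rw [hnc]; field_simp
  have hCδ : ∀ y : SpaceTimeIdx L₂ M₂, ∑ x : SpaceTimeIdx L₂ M₂,
      ‖(sectorAnalysisMatrix L₂ M₂ β F' * sectorSubMatrix L₂ M₂ β (trivialMultiplier L₂ M₂)) (x, (((1 : Fin 3), σ), 1)) (y, (((0 : Fin 1), σ), 1))‖ ≤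
      ε * N_D * ρ / ε := by
    intro y
    refine (colSum_overlap_evalMul_le hβ F' 1 (fsub K₂ K₁) Ψt c₀ 0 hF1 hND (hρ 0) σ 1 y).trans (le_of_eq ?_)
    rw [hnc]; field_simp
  have hCv : ∀ y : SpaceTimeIdx L₂ M₂, ∑ x : SpaceTimeIdx L₂ M₂,
      ‖(sectorAnalysisMatrix L₂ M₂ β F' * sectorSubMatrix L₂ M₂ β (trivialMultiplier L₂ M₂)) (x, (((2 : Fin 3), σ), 1)) (y, (((0 : Fin 1), σ), 1))‖ ≤
      (1 + ε * N_D * ρ) / ε := by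
    intro y
    refine (colSum_overlap_one_add_evalMul_le hβ F' 2 (fsub K₂ K₁) Ψt c₀ 0 hF2 hND (hρ 0) σ 1 y).trans (le_of_eq ?_)
    rw [hnc, ← hεdef]; field_simp
  have hBrow : ∑ x₁ : SpaceTimeIdx L₂ M₂, ‖sectorisedKernel L₂ M₂ β (trivialMultiplier L₂ M₂) B 2
      (![((0, σ), 0), ((0, σ), 1)] : Fin 2 → SectorLeg 1) ![of, x₁]‖ ≤ ((ε * N_D * ρ) * (1 + ε * N_D * ρ) + ε * N_D * ρ) * S_G / ε := by
    rw [le_div_iff₀ hε, mul_comm]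
    have h := fixedTupleL1_dress_sub_le hβ c v hcv G (![((0, σ), 0), ((0, σ), 1)] : Fin 2 → SectorLeg 1) of
      (Rδ := ε * N_D * ρ) (Cv := 1 + ε * N_D * ρ) (Cδ := ε * N_D * ρ) (S := S_G) (by positivity) (by positivity) hSG0
      (by simpa [hF'] using hRδ) (fun y => by simpa [hF'] using hCv y) (fun y => by simpa [hF'] using hCδ y)
      (fun y₀ => by
        have hΩ : (fun i : Fin 2 => ((((0 : Fin 1), ((![((0, σ), 0), ((0, σ), 1)] : Fin 2 → SectorLeg 1) i).1.2),
            ((![((0, σ), 0), ((0, σ), 1)] : Fin 2 → SectorLeg 1) i).2) : SectorLeg 1)) = ![((0, σ), 0), ((0, σ), 1)] := by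
          funext i; fin_cases i <;> rfl
        rw [hΩ]; exact hS σ y₀)
    rw [fixedTupleL1_one_eq_sum] at h
    refine le_trans (le_of_eq ?_) h
    rw [hεdef]
    congr 1
    refine sum_congr rfl fun x₁ _ => ?_
    rw [hB, sectorisedKernel_sub_apply]
  have hRrow : ∑ x₁ : SpaceTimeIdx L₂ M₂, ‖sectorisedKernel L₂ M₂ β (trivialMultiplier L₂ M₂) Rsp 2
      (![((0, σ), 0), ((0, σ), 1)] : Fin 2 → SectorLeg 1) ![of, x₁]‖ ≤ R := by
    rw [hRsp, hG, hT₁, hΨt, hΛn]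
    exact hR σ
  have hlift := sum_lifted_offsets_le_two_mul (M := M₂) hL
    (fun x => sectorisedKernel L₂ M₂ β (trivialMultiplier L₂ M₂) (-(A + B + Rsp)) 2 (![((0, σ), 0), ((0, σ), 1)] : Fin 2 → SectorLeg 1) x) of
  rw [hconv]
  refine hlift.trans ?_
  have hfull : ∑ x₁ : SpaceTimeIdx L₂ M₂, ‖sectorisedKernel L₂ M₂ β (trivialMultiplier L₂ M₂) (-(A + B + Rsp)) 2
      (![((0, σ), 0), ((0, σ), 1)] : Fin 2 → SectorLeg 1) ![of, x₁]‖ ≤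
      N_D ^ 2 * ρ / 2 + ((ε * N_D * ρ) * (1 + ε * N_D * ρ) + ε * N_D * ρ) * S_G / ε + R := by
    refine (sum_le_sum fun x₁ _ => hpt _).trans ?_
    rw [sum_add_distrib, sum_add_distrib]
    exact add_le_add (add_le_add hArow hBrow) hRrow
  have halg : ((ε * N_D * ρ) * (1 + ε * N_D * ρ) + ε * N_D * ρ) * S_G / ε = N_D * ρ * (2 + ε * N_D * ρ) * S_G := by
    field_simp
    ring
  rw [halg] at hfull
  calc 2 * ∑ x₁ : SpaceTimeIdx L₂ M₂, ‖sectorisedKernel L₂ M₂ β (trivialMultiplier L₂ M₂) (-(A + B + Rsp)) 2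
        (![((0, σ), 0), ((0, σ), 1)] : Fin 2 → SectorLeg 1) ![of, x₁]‖
      ≤ 2 * (N_D ^ 2 * ρ / 2 + N_D * ρ * (2 + ε * N_D * ρ) * S_G + R) := mul_le_mul_of_nonneg_left hfull (by norm_num)
    _ = N_D ^ 2 * ρ + 2 * N_D * ρ * (2 + ε * N_D * ρ) * S_G + 2 * R := by ring

/-- **`hdualSp` AT ANY SCALE `n` FROM THE COMMON-FRAME DEFECT AND THE DATA `(N_D, ρ̃, S_G, R)`** — `hPe_le_of_fourier_resummed` composed with
✓ `hdualSp_point_of_commonFrame_add_conversion`: with `ε·(Pc σ + (N_D²ρ̃ + 2N_Dρ̃(2 + εN_Dρ̃)S_G + 2R)) ≤ Dd/L₁` and `ε·Pf σ ≤ Df/L₁` the body of `hdualSp` at `n` holds at the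
pins `(oc, of)`. [cite: BenfattoGiulianiMastropietro2006, §2.4 (2.38)] -/
theorem hdualSp_point_of_fourier_resummed (hL : L₁ ≤ L₂) {β : ℝ} (hβ : 0 < β) (U μ : ℝ) (n : ℕ) (oc : SpaceTimeIdx L₁ M₂) (of : SpaceTimeIdx L₂ M₂)
    (ht : of.1 = oc.1)
    (hZ₂ : effPartitionFn ℂ (normalCovariance L₂ M₂ (uvSymbolCT L₂ M₂ β μ (klFlowFrameU L₂ M₂ β U μ n) (klScale klE0 n)))
      (hubbardInteraction L₂ M₂ β U + counterQuadratic L₂ M₂ β (klFlowFrameU L₂ M₂ β U μ n)) ≠ 0)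
    (hZ₁ : IsUnit (effPartitionFn ℂ (normalCovariance L₂ M₂ (uvSymbolCT L₂ M₂ β μ (klFlowFrameU L₁ M₂ β U μ n) (klScale klE0 n)))
      (hubbardInteraction L₂ M₂ β U + counterQuadratic L₂ M₂ β (klFlowFrameU L₁ M₂ β U μ n))))
    {N_D ρ S_G R : ℝ} (hSG0 : 0 ≤ S_G)
    (hND : ∑ z : TorusSite 2 L₂, ‖framePosKernel L₂ (fsub (klFlowFrameU L₂ M₂ β U μ n) (klFlowFrameU L₁ M₂ β U μ n)) z‖ ≤ N_D)
    (hρ : ∀ τ : Fin 2, ∑ a : TorusSite 1 (2 * M₂), ∑ bv : TorusSite 2 L₂, ‖∑ q₀ : TorusSite 1 (2 * M₂), ∑ qv : TorusSite 2 L₂,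
      torusChar q₀ a * torusChar qv bv *
        gridSymbol L₂ M₂ (2 * M₂) β (fun ks : FreqMomentum L₂ M₂ × Fin 2 =>
          uvSymbolCT L₂ M₂ β μ (klFlowFrameU L₂ M₂ β U μ n) (klScale klE0 n) ks /
            (1 + uvSymbolCT L₂ M₂ β μ (klFlowFrameU L₂ M₂ β U μ n) (klScale klE0 n) ks *
              (((fsub (klFlowFrameU L₂ M₂ β U μ n) (klFlowFrameU L₁ M₂ β U μ n)).eval (latticeMomentum L₂ ks.1.2) / (β * (L₂ : ℝ) ^ 2) : ℝ) : ℂ))) τ q₀ qv‖ ≤ ρ)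
    (hS : ∀ (σ : Fin 2) (y₀ : SpaceTimeIdx L₂ M₂),
      fixedTupleL1 L₂ M₂ β 1 (sectorisedKernel L₂ M₂ β (trivialMultiplier L₂ M₂)
          (effAction ℂ (normalCovariance L₂ M₂ fun ks : FreqMomentum L₂ M₂ × Fin 2 =>
              uvSymbolCT L₂ M₂ β μ (klFlowFrameU L₂ M₂ β U μ n) (klScale klE0 n) ks /
                  (1 + uvSymbolCT L₂ M₂ β μ (klFlowFrameU L₂ M₂ β U μ n) (klScale klE0 n) ks *
                    (((fsub (klFlowFrameU L₂ M₂ β U μ n) (klFlowFrameU L₁ M₂ β U μ n)).eval (latticeMomentum L₂ ks.1.2) / (β * (L₂ : ℝ) ^ 2) : ℝ) : ℂ)) -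
                uvSymbolCT L₂ M₂ β μ (klFlowFrameU L₁ M₂ β U μ n) (klScale klE0 n) ks)
            (klEffectiveAction L₂ M₂ β U μ (klFlowFrameU L₁ M₂ β U μ n) klE0 n)) 2)
        (![((0, σ), 0), ((0, σ), 1)] : Fin 2 → SectorLeg 1) y₀ ≤ S_G)
    (hR : ∀ σ : Fin 2, ∑ x₁ : SpaceTimeIdx L₂ M₂, ‖sectorisedKernel L₂ M₂ β (trivialMultiplier L₂ M₂)
        (effAction ℂ (normalCovariance L₂ M₂ fun ks : FreqMomentum L₂ M₂ × Fin 2 =>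
              uvSymbolCT L₂ M₂ β μ (klFlowFrameU L₂ M₂ β U μ n) (klScale klE0 n) ks /
                  (1 + uvSymbolCT L₂ M₂ β μ (klFlowFrameU L₂ M₂ β U μ n) (klScale klE0 n) ks *
                    (((fsub (klFlowFrameU L₂ M₂ β U μ n) (klFlowFrameU L₁ M₂ β U μ n)).eval (latticeMomentum L₂ ks.1.2) / (β * (L₂ : ℝ) ^ 2) : ℝ) : ℂ)) -
                uvSymbolCT L₂ M₂ β μ (klFlowFrameU L₁ M₂ β U μ n) (klScale klE0 n) ks)
            (klEffectiveAction L₂ M₂ β U μ (klFlowFrameU L₁ M₂ β U μ n) klE0 n) -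
          klEffectiveAction L₂ M₂ β U μ (klFlowFrameU L₁ M₂ β U μ n) klE0 n) 2
        (![((0, σ), 0), ((0, σ), 1)] : Fin 2 → SectorLeg 1) ![of, x₁]‖ ≤ R)
    {Pc Pf : Fin 2 → ℝ} {Dd Df : ℝ}
    (hPc : ∀ σ : Fin 2, ∑ t₁ : ImagTimeIdx M₂, ∑ ybar : TorusSite 2 L₁,
        (‖sectorisedKernel L₁ M₂ β (trivialMultiplier L₁ M₂)
              (klEffectiveAction L₁ M₂ β U μ (klFlowFrameU L₁ M₂ β U μ n) klE0 n - counterQuadratic L₁ M₂ β (klFlowFrameU L₁ M₂ β U μ n)) 2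
              (![((0, σ), 0), ((0, σ), 1)] : Fin 2 → SectorLeg 1) ![oc, (t₁, oc.2 + ybar)] -
            sectorisedKernel L₂ M₂ β (trivialMultiplier L₂ M₂)
              (klEffectiveAction L₂ M₂ β U μ (klFlowFrameU L₁ M₂ β U μ n) klE0 n - counterQuadratic L₂ M₂ β (klFlowFrameU L₁ M₂ β U μ n)) 2
              (![((0, σ), 0), ((0, σ), 1)] : Fin 2 → SectorLeg 1) ![of, (t₁, of.2 + Torus.proj L₂ (Torus.cRep ybar))]‖ +
          ‖sectorisedKernel L₁ M₂ β (trivialMultiplier L₁ M₂)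
              (klEffectiveAction L₁ M₂ β U μ (klFlowFrameU L₁ M₂ β U μ n) klE0 n - counterQuadratic L₁ M₂ β (klFlowFrameU L₁ M₂ β U μ n)) 2
              (![((0, σ), 0), ((0, σ), 1)] : Fin 2 → SectorLeg 1) ![oc, (t₁, oc.2 + -ybar)] -
            sectorisedKernel L₂ M₂ β (trivialMultiplier L₂ M₂)
              (klEffectiveAction L₂ M₂ β U μ (klFlowFrameU L₁ M₂ β U μ n) klE0 n - counterQuadratic L₂ M₂ β (klFlowFrameU L₁ M₂ β U μ n)) 2
              (![((0, σ), 0), ((0, σ), 1)] : Fin 2 → SectorLeg 1) ![of, (t₁, of.2 + -Torus.proj L₂ (Torus.cRep ybar))]‖) ≤ Pc σ)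
    (hPf : ∀ σ : Fin 2, ∑ t₁ : ImagTimeIdx M₂,
        ∑ y ∈ univ.filter (fun y : TorusSite 2 L₂ => Torus.proj L₂ (Torus.cRep (fun i => (((y i).val : ℕ) : ZMod L₁))) ≠ y),
          (‖sectorisedKernel L₂ M₂ β (trivialMultiplier L₂ M₂)
                (klEffectiveAction L₂ M₂ β U μ (klFlowFrameU L₂ M₂ β U μ n) klE0 n - counterQuadratic L₂ M₂ β (klFlowFrameU L₂ M₂ β U μ n)) 2
                (![((0, σ), 0), ((0, σ), 1)] : Fin 2 → SectorLeg 1) ![of, (t₁, of.2 + y)]‖ +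
            ‖sectorisedKernel L₂ M₂ β (trivialMultiplier L₂ M₂)
                (klEffectiveAction L₂ M₂ β U μ (klFlowFrameU L₂ M₂ β U μ n) klE0 n - counterQuadratic L₂ M₂ β (klFlowFrameU L₂ M₂ β U μ n)) 2
                (![((0, σ), 0), ((0, σ), 1)] : Fin 2 → SectorLeg 1) ![of, (t₁, of.2 + -y)]‖) ≤ Pf σ)
    (hDd : ∀ σ, imagTimeWeight β M₂ * (Pc σ + (N_D ^ 2 * ρ + 2 * N_D * ρ * (2 + imagTimeWeight β M₂ * N_D * ρ) * S_G + 2 * R)) ≤ Dd / L₁)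
    (hDf : ∀ σ, imagTimeWeight β M₂ * Pf σ ≤ Df / L₁) :
    (∀ m ∈ ({omega0 M₂, (omega0 M₂).rev} : Finset (MatsubaraIdx M₂)), ∀ σ : Fin 2, imagTimeWeight β M₂ * ∑ ybar : TorusSite 2 L₁,
        (‖(∑ t₁ : ImagTimeIdx M₂,
              sectorisedKernel L₁ M₂ β (trivialMultiplier L₁ M₂)
                  (klEffectiveAction L₁ M₂ β U μ (klFlowFrameU L₁ M₂ β U μ n) klE0 n - counterQuadratic L₁ M₂ β (klFlowFrameU L₁ M₂ β U μ n)) 2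
                  (![((0, σ), 0), ((0, σ), 1)] : Fin 2 → SectorLeg 1) ![oc, (t₁, oc.2 + ybar)] *
                Complex.exp (((matsubaraFreq β M₂ m * (imagTime β M₂ oc.1 - imagTime β M₂ t₁) : ℝ) : ℂ) * I)) -
            (∑ t₁ : ImagTimeIdx M₂,
              sectorisedKernel L₂ M₂ β (trivialMultiplier L₂ M₂)
                  (klEffectiveAction L₂ M₂ β U μ (klFlowFrameU L₂ M₂ β U μ n) klE0 n - counterQuadratic L₂ M₂ β (klFlowFrameU L₂ M₂ β U μ n)) 2
                  (![((0, σ), 0), ((0, σ), 1)] : Fin 2 → SectorLeg 1) ![of, (t₁, of.2 + Torus.proj L₂ (Torus.cRep ybar))] *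
                Complex.exp (((matsubaraFreq β M₂ m * (imagTime β M₂ of.1 - imagTime β M₂ t₁) : ℝ) : ℂ) * I))‖ +
          ‖(∑ t₁ : ImagTimeIdx M₂,
              sectorisedKernel L₁ M₂ β (trivialMultiplier L₁ M₂)
                  (klEffectiveAction L₁ M₂ β U μ (klFlowFrameU L₁ M₂ β U μ n) klE0 n - counterQuadratic L₁ M₂ β (klFlowFrameU L₁ M₂ β U μ n)) 2
                  (![((0, σ), 0), ((0, σ), 1)] : Fin 2 → SectorLeg 1) ![oc, (t₁, oc.2 + -ybar)] *
                Complex.exp (((matsubaraFreq β M₂ m * (imagTime β M₂ oc.1 - imagTime β M₂ t₁) : ℝ) : ℂ) * I)) -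
            (∑ t₁ : ImagTimeIdx M₂,
              sectorisedKernel L₂ M₂ β (trivialMultiplier L₂ M₂)
                  (klEffectiveAction L₂ M₂ β U μ (klFlowFrameU L₂ M₂ β U μ n) klE0 n - counterQuadratic L₂ M₂ β (klFlowFrameU L₂ M₂ β U μ n)) 2
                  (![((0, σ), 0), ((0, σ), 1)] : Fin 2 → SectorLeg 1) ![of, (t₁, of.2 + -Torus.proj L₂ (Torus.cRep ybar))] *
                Complex.exp (((matsubaraFreq β M₂ m * (imagTime β M₂ of.1 - imagTime β M₂ t₁) : ℝ) : ℂ) * I))‖) ≤ Dd / L₁) ∧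
    (∀ m ∈ ({omega0 M₂, (omega0 M₂).rev} : Finset (MatsubaraIdx M₂)), ∀ σ : Fin 2, imagTimeWeight β M₂ *
        ∑ y ∈ univ.filter (fun y : TorusSite 2 L₂ => Torus.proj L₂ (Torus.cRep (fun i => (((y i).val : ℕ) : ZMod L₁))) ≠ y),
          (‖(∑ t₁ : ImagTimeIdx M₂,
              sectorisedKernel L₂ M₂ β (trivialMultiplier L₂ M₂)
                  (klEffectiveAction L₂ M₂ β U μ (klFlowFrameU L₂ M₂ β U μ n) klE0 n - counterQuadratic L₂ M₂ β (klFlowFrameU L₂ M₂ β U μ n)) 2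
                  (![((0, σ), 0), ((0, σ), 1)] : Fin 2 → SectorLeg 1) ![of, (t₁, of.2 + y)] *
                Complex.exp (((matsubaraFreq β M₂ m * (imagTime β M₂ of.1 - imagTime β M₂ t₁) : ℝ) : ℂ) * I))‖ +
            ‖(∑ t₁ : ImagTimeIdx M₂,
              sectorisedKernel L₂ M₂ β (trivialMultiplier L₂ M₂)
                  (klEffectiveAction L₂ M₂ β U μ (klFlowFrameU L₂ M₂ β U μ n) klE0 n - counterQuadratic L₂ M₂ β (klFlowFrameU L₂ M₂ β U μ n)) 2
                  (![((0, σ), 0), ((0, σ), 1)] : Fin 2 → SectorLeg 1) ![of, (t₁, of.2 + -y)] *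
                Complex.exp (((matsubaraFreq β M₂ m * (imagTime β M₂ of.1 - imagTime β M₂ t₁) : ℝ) : ℂ) * I))‖) ≤ Df / L₁) :=
  hdualSp_point_of_commonFrame_add_conversion hβ.le U μ n oc of ht
    (Pe := fun _ => N_D ^ 2 * ρ + 2 * N_D * ρ * (2 + imagTimeWeight β M₂ * N_D * ρ) * S_G + 2 * R)
    hPc (hPe_le_of_fourier_resummed hL hβ U μ n of hZ₂ hZ₁ hSG0 hND hρ hS hR) hPf hDd hDf

end AnyScale

end Summit.HubbardSuperconductivity.HubbardSuperconductivity.Theorems.TwoVolumeDefect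

end
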